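import Summits.AnomalousDissipation.AnomalousDissipation.Theorems.MomentParityPathField
import Literature.Analysis.FluidPDE.StatisticalSolutionEnergyEq
import Literature.Analysis.FluidPDE.CylindricalGenerator

/-!
# Crux `EnsembleRealization` (stmt-AnomalousDissipation-0215) — line `augmented-lift`, tools stub
# `stub_cylEnergyIneqGalerkinIdentity` (S1) for `stub_cylEnergyIneq`

The Liouville equation (1.30) of a stationary statistical solution `μ` (Foias–Manley–Rosa–Temam
2001, Ch. IV Def. 1.3) tested on the cylindrical functional `u ↦ ψ(ξ(u), |P_K u|²)`,
`ξ(u) = ((u, g₁), …, (u, g_m))`, `|P_K u|² = truncNormSq K u`: its coordinates are the `m`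
pairings `(u, gⱼ)` followed by the pairings with the Parseval frame of `P_K H` (`galerkinTest`),
and — the class `CylindricalTest` wanting a compactly supported profile while `ψ` is only `C¹` —
the profile `ψ(ζ, ‖η‖²)` is multiplied by the cut-off `χ(‖(ζ, η)‖²/a)` (`χ = galerkinCutoff`) at a
level `a` so large that `χ = 1` on the coordinate range of the ball `‖u‖ ≤ R` carrying `μ`
(`exists_cylGITest`). On that ball `Ψ'(u) = Σⱼ ∂ⱼψ_K gⱼ + 2 ∂ₑψ_K P_K u`, and
`⟨F(u), c P_K u⟩ = c · galerkinBalance ν f K u`, whence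
`∫ ⟨F(u), Σⱼ ∂ⱼψ_K gⱼ⟩ dμ + 2 ∫ ∂ₑψ_K galerkinBalance ν f K u dμ = 0` with both integrands
integrable (the balance is integrable on the ball, `cylGI_integrable_galerkinBalance`; the weight
`∂ₑψ_K` is continuous and bounded there, `exists_bound_fderiv_cylXi`).
-/

noncomputable section
-- every `Summit.AnomalousDissipation.AnomalousDissipation.…` name repeats the summit = sub-problem segment (D-0017 layout)
set_option linter.dupNamespace false

open MeasureTheory Set Filter Topology Function Metric UnitAddTorus
open scoped BigOperators ENNReal InnerProductSpace RealInnerProductSpace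
namespace Summit.AnomalousDissipation.AnomalousDissipation.Theorems.EnsembleRealization

open Literature.Analysis.FunctionSpaces Literature.Analysis.FunctionSpaces.Torus
open Literature.Analysis.FluidPDE Literature.Analysis.FluidPDE.Torus
open Summit.AnomalousDissipation.AnomalousDissipation.Theorems.MomentParity

variable {ν : ℝ} {f : UnitAddTorus (Fin 3) → EuclideanSpace ℝ (Fin 3)}
  {μ : Measure (Torus.energySpace (Fin 3))}

/-! ### Head and tail coordinates of `ℝ^{n+D} ≃ ℝ^n × ℝ^D` -/

/-- A basis vector with a head index splits as `(eᵢ, 0)`. -/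
private theorem cylGI_split_single_castAdd (n D : ℕ) (i : Fin n) :
    EuclideanSpace.finAddEquivProd (𝕜 := ℝ) (EuclideanSpace.single (Fin.castAdd D i) (1 : ℝ)) =
      (EuclideanSpace.single i 1, 0) := by
  refine Prod.ext ?_ ?_ <;> ext i' <;> simp [PiLp.single_apply]

/-- A basis vector with a tail index splits as `(0, eⱼ)`. -/
private theorem cylGI_split_single_natAdd (n D : ℕ) (j : Fin D) :
    EuclideanSpace.finAddEquivProd (𝕜 := ℝ) (EuclideanSpace.single (Fin.natAdd n j) (1 : ℝ)) =
      (0, EuclideanSpace.single j 1) := by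
  refine Prod.ext ?_ ?_ <;> ext i' <;> simp [PiLp.single_apply]

/-- `‖z‖² = ‖z_head‖² + ‖z_tail‖²`. -/
private theorem cylGI_norm_sq_eq (n D : ℕ) (z : EuclideanSpace ℝ (Fin (n + D))) :
    ‖z‖ ^ 2 = ‖(EuclideanSpace.finAddEquivProd (𝕜 := ℝ) z).1‖ ^ 2 +
      ‖(EuclideanSpace.finAddEquivProd (𝕜 := ℝ) z).2‖ ^ 2 := by
  rw [EuclideanSpace.real_norm_sq_eq, EuclideanSpace.real_norm_sq_eq,
    EuclideanSpace.real_norm_sq_eq, Fin.sum_univ_add]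
  simp

/-! ### The profile `Π(z) = ψ(z_head, ‖z_tail‖²) χ(‖z‖²/a)` on `ℝ^{n+D}` -/

/-- The cut-off cylindrical profile is `C¹`. -/
theorem cylGI_contDiff_profile {n : ℕ} (D : ℕ) {ψ : EuclideanSpace ℝ (Fin n) × ℝ → ℝ}
    (hψ : ContDiff ℝ 1 ψ) (a : ℝ) : ContDiff ℝ 1 (fun z : EuclideanSpace ℝ (Fin (n + D)) =>
      ψ ((EuclideanSpace.finAddEquivProd (𝕜 := ℝ) z).1,
          ‖(EuclideanSpace.finAddEquivProd (𝕜 := ℝ) z).2‖ ^ 2) *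
        (galerkinCutoff : ℝ → ℝ) (‖z‖ ^ 2 / a)) := by
  have hE := (EuclideanSpace.finAddEquivProd (𝕜 := ℝ) (n := n) (m := D)).contDiff (n := 1)
  exact (hψ.comp (hE.fst.prodMk ((contDiff_norm_sq ℝ).comp hE.snd))).mul
    ((galerkinCutoff.contDiff (n := 1)).comp ((contDiff_norm_sq ℝ).div_const a))

/-- The cut-off cylindrical profile has compact support (`a > 0`). -/
theorem cylGI_hasCompactSupport_profile {n : ℕ} (D : ℕ) (ψ : EuclideanSpace ℝ (Fin n) × ℝ → ℝ)
    {a : ℝ} (ha : 0 < a) : HasCompactSupport (fun z : EuclideanSpace ℝ (Fin (n + D)) =>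
      ψ ((EuclideanSpace.finAddEquivProd (𝕜 := ℝ) z).1,
          ‖(EuclideanSpace.finAddEquivProd (𝕜 := ℝ) z).2‖ ^ 2) *
        (galerkinCutoff : ℝ → ℝ) (‖z‖ ^ 2 / a)) := by
  refine HasCompactSupport.intro (isCompact_closedBall (0 : EuclideanSpace ℝ (Fin (n + D)))
    (Real.sqrt (2 * a))) fun z hz => ?_
  rw [Metric.mem_closedBall, dist_zero_right, not_le] at hz
  have h2 : 2 * a < ‖z‖ ^ 2 := (Real.sqrt_lt' ((Real.sqrt_nonneg _).trans_lt hz)).1 hz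
  have h3 : galerkinCutoff.rOut ≤ dist (‖z‖ ^ 2 / a) 0 := by
    rw [Real.dist_eq, sub_zero, abs_of_nonneg (by positivity)]
    show (2 : ℝ) ≤ ‖z‖ ^ 2 / a
    rw [le_div_iff₀ ha]
    linarith
  rw [galerkinCutoff.zero_of_le_dist h3, mul_zero]

/-- **Differential of the profile inside the level ball** `‖z‖² ≤ a`: the cut-off is flat there,
`DΠ(z) e = Dψ(z_head, ‖z_tail‖²) (e_head, 2 ⟪z_tail, e_tail⟫)`. -/
theorem cylGI_fderiv_profile {n : ℕ} (D : ℕ) {ψ : EuclideanSpace ℝ (Fin n) × ℝ → ℝ}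
    (hψ : ContDiff ℝ 1 ψ) {a : ℝ} (ha : 0 < a) {z : EuclideanSpace ℝ (Fin (n + D))}
    (hz : ‖z‖ ^ 2 ≤ a) (e : EuclideanSpace ℝ (Fin (n + D))) :
    fderiv ℝ (fun z : EuclideanSpace ℝ (Fin (n + D)) =>
      ψ ((EuclideanSpace.finAddEquivProd (𝕜 := ℝ) z).1,
          ‖(EuclideanSpace.finAddEquivProd (𝕜 := ℝ) z).2‖ ^ 2) *
        (galerkinCutoff : ℝ → ℝ) (‖z‖ ^ 2 / a)) z e =
      fderiv ℝ ψ ((EuclideanSpace.finAddEquivProd (𝕜 := ℝ) z).1,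
          ‖(EuclideanSpace.finAddEquivProd (𝕜 := ℝ) z).2‖ ^ 2)
        ((EuclideanSpace.finAddEquivProd (𝕜 := ℝ) e).1,
          2 * ⟪(EuclideanSpace.finAddEquivProd (𝕜 := ℝ) z).2,
            (EuclideanSpace.finAddEquivProd (𝕜 := ℝ) e).2⟫_ℝ) := by
  -- the cut-off is flat on `[-1, 1]`
  have h1 : (galerkinCutoff : ℝ → ℝ) (‖z‖ ^ 2 / a) = 1 :=
    galerkinCutoff.one_of_mem_closedBall (by
      rw [Metric.mem_closedBall, dist_zero_right, Real.norm_eq_abs, abs_of_nonneg (by positivity)]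
      exact (div_le_one ha).2 hz)
  have h1' : deriv (galerkinCutoff : ℝ → ℝ) (‖z‖ ^ 2 / a) = 0 := by
    refine IsLocalMax.deriv_eq_zero ?_
    filter_upwards with s
    rw [h1]
    exact galerkinCutoff.le_one
  -- the inner map `z ↦ (z_head, ‖z_tail‖²)` and the factor `ψ(z_head, ‖z_tail‖²)`
  have hI := (EuclideanSpace.finAddEquivProd (𝕜 := ℝ) (n := n) (m := D)).hasFDerivAt.fst.prodMk
    ((hasStrictFDerivAt_norm_sq _).hasFDerivAt.comp z
      (EuclideanSpace.finAddEquivProd (𝕜 := ℝ) (n := n) (m := D)).hasFDerivAt.snd)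
  have hA := (((hψ.differentiable one_ne_zero) _).hasFDerivAt).comp z hI
  -- the cut-off factor
  have hχ : HasDerivAt (fun s : ℝ => (galerkinCutoff : ℝ → ℝ) (s / a))
      (deriv (galerkinCutoff : ℝ → ℝ) (‖z‖ ^ 2 / a) * (1 / a)) (‖z‖ ^ 2) := by
    have hd := ((((galerkinCutoff.contDiff (n := 1)).differentiable (by simp))
      (‖z‖ ^ 2 / a)).hasDerivAt).comp (‖z‖ ^ 2) ((hasDerivAt_id (‖z‖ ^ 2)).div_const a)
    exact hd
  have hB := hχ.comp_hasFDerivAt z (hasStrictFDerivAt_norm_sq z).hasFDerivAt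
  have key : HasFDerivAt (fun z : EuclideanSpace ℝ (Fin (n + D)) =>
        ψ ((EuclideanSpace.finAddEquivProd (𝕜 := ℝ) z).1,
            ‖(EuclideanSpace.finAddEquivProd (𝕜 := ℝ) z).2‖ ^ 2) *
          (galerkinCutoff : ℝ → ℝ) (‖z‖ ^ 2 / a)) _ z := hA.mul hB
  rw [key.fderiv]
  simp only [_root_.add_apply, _root_.smul_apply,
    ContinuousLinearMap.comp_apply, ContinuousLinearMap.coe_fst', ContinuousLinearMap.coe_snd',
    ContinuousLinearEquiv.coe_coe, ContinuousLinearMap.prod_apply, innerSL_apply_apply, smul_eq_mul,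
    nsmul_eq_mul, Function.comp_apply, Nat.cast_ofNat, h1, h1', zero_mul, mul_zero,
    zero_add, one_mul]

/-- Linearity of `Dψ(p)` in the energy slot: `Dψ(p)(0, r) = r Dψ(p)(0, 1)`. -/
theorem cylGI_fderiv_apply_zero_left {n : ℕ} (ψ : EuclideanSpace ℝ (Fin n) × ℝ → ℝ)
    (p : EuclideanSpace ℝ (Fin n) × ℝ) (r : ℝ) :
    fderiv ℝ ψ p ((0 : EuclideanSpace ℝ (Fin n)), r) = r * fderiv ℝ ψ p (0, 1) := by
  rw [show ((0 : EuclideanSpace ℝ (Fin n)), r) = r • ((0 : EuclideanSpace ℝ (Fin n)), (1 : ℝ)) by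
    rw [Prod.smul_mk, smul_zero, smul_eq_mul, mul_one], map_smul, smul_eq_mul]

/-! ### The cut-off cylindrical–Galerkin test functional -/

variable {m : ℕ} {g : Fin m → UnitAddTorus (Fin 3) → EuclideanSpace ℝ (Fin 3)}
  {ψ : EuclideanSpace ℝ (Fin m) × ℝ → ℝ}

/-- **The cut-off cylindrical–Galerkin test functional and its differential on the level ball.**
For smooth solenoidal mean-zero `g₁, …, g_m`, a `C¹` profile `ψ`, an order `K` and a level `a > 0`
there is a cylindrical test `Ψ` — fields `g` followed (`Fin.append`) by the Parseval frame of
`P_K H` (`galerkinTest`), profile `ψ(z_head, ‖z_tail‖²) χ(‖z‖²/a)` — such that for every `u ∈ H`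
with `‖ξ(u)‖² + |P_K u|² ≤ a` (`ξ(u) = ((u, g₁), …, (u, g_m))`),
`Ψ'(u) = Σⱼ ∂ⱼψ(ξ(u), |P_K u|²) gⱼ + 2 ∂ₑψ(ξ(u), |P_K u|²) P_K u`
(the frame reproduces the truncation: `Σ_p (u, e_p) e_p = P_K u`, `Σ_p (u, e_p)² = |P_K u|²`). -/
theorem exists_cylGITest (hg : ∀ j, IsSmooth (g j)) (hgd : ∀ j, IsDivFree (g j))
    (hg0 : ∀ j, HasZeroMean (g j)) (hψ : ContDiff ℝ 1 ψ) (K : ℕ) {a : ℝ} (ha : 0 < a) :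
    ∃ Ψ : CylindricalTest (Fin 3), ∀ u : Torus.energySpace (Fin 3),
      ‖(WithLp.toLp 2 fun j => pairing u.1 (g j) : EuclideanSpace ℝ (Fin m))‖ ^ 2 +
          truncNormSq K u ≤ a →
        Ψ.grad u = fun x =>
          ∑ j, fderiv ℝ ψ (WithLp.toLp 2 fun j => pairing u.1 (g j), truncNormSq K u)
              (EuclideanSpace.single j 1, 0) • g j x +
            (2 * fderiv ℝ ψ (WithLp.toLp 2 fun j => pairing u.1 (g j), truncNormSq K u) (0, 1)) •
              fourierTruncate K (u.1 : UnitAddTorus (Fin 3) → EuclideanSpace ℝ (Fin 3)) x := by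
  set G : CylindricalTest (Fin 3) := galerkinTest (d := Fin 3) K (a := 1) one_pos with hG
  refine ⟨
    { m := m + G.m
      g := Fin.append g G.g
      g_smooth := fun l => by
        induction l using Fin.addCases with
        | left i => simpa only [Fin.append_left] using hg i
        | right j => simpa only [Fin.append_right] using G.g_smooth j
      g_divFree := fun l => by
        induction l using Fin.addCases with
        | left i => simpa only [Fin.append_left] using hgd i
        | right j => simpa only [Fin.append_right] using G.g_divFree j
      g_zeroMean := fun l => by
        induction l using Fin.addCases with
        | left i => simpa only [Fin.append_left] using hg0 i
        | right j => simpa only [Fin.append_right] using G.g_zeroMean j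
      φ := fun z : EuclideanSpace ℝ (Fin (m + G.m)) =>
        ψ ((EuclideanSpace.finAddEquivProd (𝕜 := ℝ) z).1,
            ‖(EuclideanSpace.finAddEquivProd (𝕜 := ℝ) z).2‖ ^ 2) *
          (galerkinCutoff : ℝ → ℝ) (‖z‖ ^ 2 / a)
      φ_contDiff := cylGI_contDiff_profile _ hψ a
      φ_compact := cylGI_hasCompactSupport_profile _ ψ ha }, fun u hu => ?_⟩
  -- the coordinates of `u`: head `ξ(u)`, tail `G.coords u`
  set c : EuclideanSpace ℝ (Fin (m + G.m)) :=
    WithLp.toLp 2 fun l => pairing u.1 (Fin.append g G.g l) with hc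
  have hc1 : (EuclideanSpace.finAddEquivProd c).1 =
      (WithLp.toLp 2 fun j => pairing u.1 (g j) : EuclideanSpace ℝ (Fin m)) := by
    ext i
    simp [hc, Fin.append_left]
  have hc2 : (EuclideanSpace.finAddEquivProd c).2 = G.coords u := by
    ext j
    simp [hc, CylindricalTest.coords, Fin.append_right]
  have hnorm : ‖G.coords u‖ ^ 2 = truncNormSq K u := norm_sq_galerkinTest_coords K one_pos u
  have hcz : ‖c‖ ^ 2 ≤ a := by
    rw [cylGI_norm_sq_eq, hc1, hc2, hnorm]
    exact hu
  funext x
  -- the frame reproduces the truncation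
  have hsum : ∑ j, G.coords u j • G.g j x =
      fourierTruncate K (u.1 : UnitAddTorus (Fin 3) → EuclideanSpace ℝ (Fin 3)) x := by
    rw [← sum_integral_inner_frameField_smul u.2 K x]
    exact sum_galerkinTest_eq K one_pos (fun g => pairing u.1 g • g x)
  change (∑ l : Fin (m + G.m), fderiv ℝ (fun z : EuclideanSpace ℝ (Fin (m + G.m)) =>
      ψ ((EuclideanSpace.finAddEquivProd (𝕜 := ℝ) z).1,
          ‖(EuclideanSpace.finAddEquivProd (𝕜 := ℝ) z).2‖ ^ 2) *
        (galerkinCutoff : ℝ → ℝ) (‖z‖ ^ 2 / a)) c (EuclideanSpace.single l 1) •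
    Fin.append g G.g l x) = _
  rw [Fin.sum_univ_add]
  simp only [Fin.append_left, Fin.append_right, cylGI_fderiv_profile _ hψ ha hcz,
    cylGI_split_single_castAdd, cylGI_split_single_natAdd, hc1, hc2, hnorm, inner_zero_right,
    mul_zero, EuclideanSpace.inner_single_right, one_mul, RCLike.conj_to_real]
  rw [← hsum, Finset.smul_sum]
  refine congrArg₂ (· + ·) rfl (Finset.sum_congr rfl fun j _ => ?_)
  rw [cylGI_fderiv_apply_zero_left, smul_smul]
  refine congrArg (fun r : ℝ => r • G.g j x) ?_
  ring

/-! ### The generator on the two-term field; coordinates on the support ball -/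

/-- `⟨F(u), P_K u⟩ = galerkinBalance ν f K u` (`nsGeneratorPairing_smul_fourierTruncate`, `c = 1`). -/
theorem cylGI_nsGeneratorPairing_fourierTruncate (ν : ℝ) (f : UnitAddTorus (Fin 3) → EuclideanSpace ℝ (Fin 3))
    (u : Torus.energySpace (Fin 3)) (K : ℕ) :
    nsGeneratorPairing ν f u (fourierTruncate K (u.1 : UnitAddTorus (Fin 3) → EuclideanSpace ℝ (Fin 3))) =
      galerkinBalance ν f K u := by
  have h := nsGeneratorPairing_smul_fourierTruncate ν f u 1 K
  simp only [one_smul, one_mul] at h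
  rw [galerkinBalance]
  exact h

/-- **The tested generator on the two-term field**: for smooth `f`, `w`,
`⟨F(u), w + c P_K u⟩ = ⟨F(u), w⟩ + c · galerkinBalance ν f K u` (linearity in the test field,
`nsGeneratorPairing_sum_smul`). -/
theorem cylGI_nsGeneratorPairing_add_smul (ν : ℝ) {f : UnitAddTorus (Fin 3) → EuclideanSpace ℝ (Fin 3)}
    (hf : IsSmooth f) (u : Torus.energySpace (Fin 3)) {w : UnitAddTorus (Fin 3) → EuclideanSpace ℝ (Fin 3)}
    (hw : IsSmooth w) (c : ℝ) (K : ℕ) :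
    nsGeneratorPairing ν f u
        (fun x => w x + c • fourierTruncate K (u.1 : UnitAddTorus (Fin 3) → EuclideanSpace ℝ (Fin 3)) x) =
      nsGeneratorPairing ν f u w + c * galerkinBalance ν f K u := by
  have hws : IsSmooth (fourierTruncate K (u.1 : UnitAddTorus (Fin 3) → EuclideanSpace ℝ (Fin 3))) :=
    isSmooth_fourierTruncate K _
  have hsum := nsGeneratorPairing_sum_smul ν hf.integrable u Finset.univ ![1, c]
    (g := ![w, fourierTruncate K (u.1 : UnitAddTorus (Fin 3) → EuclideanSpace ℝ (Fin 3))])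
    (fun i _ => by
      fin_cases i
      · exact hw
      · exact hws)
  simp only [Fin.sum_univ_two, Matrix.cons_val_zero, Matrix.cons_val_one, one_smul, one_mul,
    cylGI_nsGeneratorPairing_fourierTruncate] at hsum
  exact hsum

/-- The cylindrical coordinates `u ↦ ξ(u) = ((u, g₁), …, (u, g_m))` are continuous on `H`. -/
theorem continuous_cylXi (hg : ∀ j, IsSmooth (g j)) :
    Continuous fun u : Torus.energySpace (Fin 3) =>
      (WithLp.toLp 2 fun j => pairing u.1 (g j) : EuclideanSpace ℝ (Fin m)) :=
  (PiLp.continuous_toLp 2 _).comp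
    (continuous_pi fun j => continuous_pairing_coe ((hg j).memLp 2))

/-- `u ↦ |P_K u|²` is continuous on `H` (a finite sum of squares of Fourier coefficients). -/
theorem cylGI_continuous_truncNormSq (K : ℕ) :
    Continuous fun u : Torus.energySpace (Fin 3) => truncNormSq K u := by
  have h : (fun u : Torus.energySpace (Fin 3) => truncNormSq K u) = fun u => ∑ k ∈ freqBall K,
      ‖mFourierCoeff (EuclideanSpace.complexify ∘ (u.1 : UnitAddTorus (Fin 3) → EuclideanSpace ℝ (Fin 3))) k‖ ^ 2 := by
    funext u
    exact integral_norm_sq_fourierTruncate ((Lp.memLp u.1).integrable one_le_two) K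
  rw [h]
  exact continuous_finsetSum _ fun k _ =>
    (((continuous_mFourierCoeff_complexify_coe k).comp continuous_subtype_val).norm).pow 2

/-- The weights `u ↦ Dψ(ξ(u), e(u)) v` are continuous on `H` for a continuous energy `e`. -/
theorem continuous_fderiv_cylXi (hg : ∀ j, IsSmooth (g j)) (hψ : ContDiff ℝ 1 ψ)
    {e : Torus.energySpace (Fin 3) → ℝ} (he : Continuous e) (v : EuclideanSpace ℝ (Fin m) × ℝ) :
    Continuous fun u : Torus.energySpace (Fin 3) =>
      fderiv ℝ ψ (WithLp.toLp 2 fun j => pairing u.1 (g j), e u) v :=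
  (ContinuousLinearMap.apply ℝ ℝ v).continuous.comp
    ((hψ.continuous_fderiv one_ne_zero).comp ((continuous_cylXi hg).prodMk he))

/-- On the ball `‖u‖ ≤ R`: `‖ξ(u)‖² ≤ R² Σⱼ ‖gⱼ‖₂²` (Cauchy–Schwarz coordinatewise). -/
theorem norm_cylXi_sq_le (hg : ∀ j, IsSmooth (g j)) {R : ℝ} {u : Torus.energySpace (Fin 3)}
    (hu : ‖u‖ ≤ R) :
    ‖(WithLp.toLp 2 fun j => pairing u.1 (g j) : EuclideanSpace ℝ (Fin m))‖ ^ 2 ≤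
      R ^ 2 * ∑ j, ‖((hg j).memLp 2).toLp (g j)‖ ^ 2 := by
  rw [EuclideanSpace.real_norm_sq_eq, Finset.mul_sum]
  refine Finset.sum_le_sum fun j _ => ?_
  have h := abs_pairing_coe_le ((hg j).memLp 2) u
  rw [PiLp.toLp_apply]
  calc pairing u.1 (g j) ^ 2 = |pairing u.1 (g j)| ^ 2 := (sq_abs _).symm
    _ ≤ (‖u‖ * ‖((hg j).memLp 2).toLp (g j)‖) ^ 2 := pow_le_pow_left₀ (abs_nonneg _) h 2
    _ ≤ (R * ‖((hg j).memLp 2).toLp (g j)‖) ^ 2 :=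
        pow_le_pow_left₀ (by positivity) (mul_le_mul_of_nonneg_right hu (norm_nonneg _)) 2
    _ = R ^ 2 * ‖((hg j).memLp 2).toLp (g j)‖ ^ 2 := by ring

/-- **`Dψ` is bounded on the coordinate range of the ball**: `|Dψ(ξ(u), t) v| ≤ M ‖v‖` whenever
`‖u‖ ≤ R` and `|t| ≤ R²` (continuity of `Dψ` on a compact `closedBall × closedBall`). -/
theorem exists_bound_fderiv_cylXi (hg : ∀ j, IsSmooth (g j)) (hψ : ContDiff ℝ 1 ψ) (R : ℝ) :
    ∃ M : ℝ, 0 ≤ M ∧ ∀ u : Torus.energySpace (Fin 3), ‖u‖ ≤ R → ∀ t : ℝ, |t| ≤ R ^ 2 →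
      ∀ v : EuclideanSpace ℝ (Fin m) × ℝ,
        |fderiv ℝ ψ (WithLp.toLp 2 fun j => pairing u.1 (g j), t) v| ≤ M * ‖v‖ := by
  obtain ⟨M, hM⟩ := ((isCompact_closedBall (0 : EuclideanSpace ℝ (Fin m))
    (Real.sqrt (R ^ 2 * ∑ j, ‖((hg j).memLp 2).toLp (g j)‖ ^ 2))).prod
      (isCompact_closedBall (0 : ℝ) (R ^ 2))).exists_bound_of_continuousOn
    (hψ.continuous_fderiv one_ne_zero).continuousOn
  refine ⟨max M 0, le_max_right _ _, fun u hu t ht v => ?_⟩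
  have h1 := Real.abs_le_sqrt (norm_cylXi_sq_le hg hu)
  rw [abs_norm] at h1
  have hmem := Set.mk_mem_prod (mem_closedBall_zero_iff.2 h1)
    (mem_closedBall_zero_iff.2 ((Real.norm_eq_abs t).trans_le ht))
  rw [← Real.norm_eq_abs]
  calc ‖fderiv ℝ ψ (WithLp.toLp 2 fun j => pairing u.1 (g j), t) v‖
      ≤ ‖fderiv ℝ ψ (WithLp.toLp 2 fun j => pairing u.1 (g j), t)‖ * ‖v‖ :=
        ContinuousLinearMap.le_opNorm _ _
    _ ≤ M * ‖v‖ := mul_le_mul_of_nonneg_right (hM _ hmem) (norm_nonneg _)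
    _ ≤ max M 0 * ‖v‖ := mul_le_mul_of_nonneg_right (le_max_left _ _) (norm_nonneg _)

/-- **On a stationary statistical solution carried by the ball `‖u‖ ≤ R` every Galerkin energy
balance `u ↦ galerkinBalance ν f K u` is integrable**: it agrees `μ`-a.e. with the weighted
balance of `integral_galerkinBalance_eq_zero` at the level `R² + 1` (weight `1` on the ball). -/
theorem cylGI_integrable_galerkinBalance (hμ : IsStationaryStatisticalSolution ν f μ) {R : ℝ}
    (hR : ∀ᵐ u ∂μ, ‖u‖ ≤ R) (K : ℕ) :
    Integrable (fun u : Torus.energySpace (Fin 3) => galerkinBalance ν f K u) μ := by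
  have ha : (0 : ℝ) < R ^ 2 + 1 := by positivity
  refine ((hμ.integral_galerkinBalance_eq_zero K ha).1).congr ?_
  filter_upwards [hR] with u hu
  have ht : |truncNormSq K u / (R ^ 2 + 1)| ≤ 1 := by
    rw [abs_of_nonneg (div_nonneg (truncNormSq_nonneg K u) ha.le), div_le_one ha]
    have h1 := truncNormSq_le K u
    have h2 : ‖u‖ ^ 2 ≤ R ^ 2 := pow_le_pow_left₀ (norm_nonneg _) hu 2
    linarith
  rw [galerkinWeight_eq_one ht, one_mul]

/-- On the ball, `|P_K u|² ≤ R²`. -/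
theorem cylGI_abs_truncNormSq_le {R : ℝ} {u : Torus.energySpace (Fin 3)} (hu : ‖u‖ ≤ R) (K : ℕ) : |truncNormSq K u| ≤ R ^ 2 := by
  rw [abs_of_nonneg (truncNormSq_nonneg K u)]
  exact (truncNormSq_le K u).trans (pow_le_pow_left₀ (norm_nonneg _) hu 2)

/-! ### The stub -/

/-- **S1 `stub_cylEnergyIneqGalerkinIdentity` — the Liouville identity on the cut-off
cylindrical–Galerkin functional.** For a stationary statistical solution `μ` at `(ν, f)`, `f`
smooth, carried by the ball `‖u‖ ≤ R`, smooth solenoidal mean-zero `g₁, …, g_m`, a `C¹` profile `ψ`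
and an order `K` (`ψ_K(u) = ψ(ξ(u), |P_K u|²)`): `u ↦ ⟨F(u), Σⱼ ∂ⱼψ_K(u) gⱼ⟩` and
`u ↦ ∂ₑψ_K(u) galerkinBalance ν f K u` are `μ`-integrable and
`∫ ⟨F(u), Σⱼ ∂ⱼψ_K(u) gⱼ⟩ dμ + 2 ∫ ∂ₑψ_K(u) galerkinBalance ν f K u dμ = 0` — (1.30) tested on
the test of `exists_cylGITest` at a level whose cut-off is `1` on the ball.
[FMRTTurbulence2001, Ch. IV §1.2 (1.30) and the example after Def. 1.2] -/
theorem stub_cylEnergyIneqGalerkinIdentity (hf : IsSmooth f) (hμ : IsStationaryStatisticalSolution ν f μ) {R : ℝ} (hR : ∀ᵐ u ∂μ, ‖u‖ ≤ R) {m : ℕ} {g : Fin m → UnitAddTorus (Fin 3) → EuclideanSpace ℝ (Fin 3)} (hg : ∀ j, IsSmooth (g j)) (hgd : ∀ j, IsDivFree (g j)) (hg0 : ∀ j, HasZeroMean (g j)) {ψ : EuclideanSpace ℝ (Fin m) × ℝ → ℝ} (hψ : ContDiff ℝ 1 ψ) (K : ℕ) : Integrable (fun u : Torus.energySpace (Fin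 3) => nsGeneratorPairing ν f u (fun x => ∑ j, fderiv ℝ ψ (WithLp.toLp 2 fun j => pairing u.1 (g j), truncNormSq K u) (EuclideanSpace.single j 1, 0) • g j x)) μ ∧ Integrable (fun u : Torus.energySpace (Fin 3) => fderiv ℝ ψ (WithLp.toLp 2 fun j => pairing u.1 (g j), truncNormSq K u) (0, 1) * galerkinBalance ν f K u) μ ∧ ∫ u, nsGeneratorPairing ν f u (fun x => ∑ j, fderiv ℝ ψ (WithLp.toLp 2 fun j => pairing u.1 (g j), truncNormSq K u) (EuclideanSpace.single j 1, 0) • g j x) ∂μ + 2 * ∫ u, fderiv ℝ ψ (WithLp.toLp 2 fun j => pairing u.1 (g j), truncNormSq K u) (0, 1) * galerkinBalance ν f K u ∂μ = 0 := by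
  -- the level `a`: the cut-off is `1` on the coordinate range of the ball `‖u‖ ≤ R`
  set Sg : ℝ := ∑ j, ‖((hg j).memLp 2).toLp (g j)‖ ^ 2 with hSg
  have hSg0 : 0 ≤ Sg := Finset.sum_nonneg fun _ _ => sq_nonneg _
  have ha : (0 : ℝ) < R ^ 2 * (Sg + 1) + 1 := by positivity
  obtain ⟨Ψ, hΨ⟩ := exists_cylGITest hg hgd hg0 hψ K ha
  obtain ⟨hLint, hL0⟩ := hμ.generator Ψ
  set A : Torus.energySpace (Fin 3) → ℝ := fun u => nsGeneratorPairing ν f u (fun x => ∑ j,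
    fderiv ℝ ψ (WithLp.toLp 2 fun j => pairing u.1 (g j), truncNormSq K u)
      (EuclideanSpace.single j 1, 0) • g j x) with hA
  set B : Torus.energySpace (Fin 3) → ℝ := fun u =>
    fderiv ℝ ψ (WithLp.toLp 2 fun j => pairing u.1 (g j), truncNormSq K u) (0, 1) *
      galerkinBalance ν f K u with hB
  -- on the ball, `⟨F(u), Ψ'(u)⟩ = A u + 2 B u`
  have hae : ∀ᵐ u ∂μ,
      nsGeneratorPairing ν f u (Ψ.grad u) = A u + 2 * B u := by
    filter_upwards [hR] with u hu
    have hball : ‖(WithLp.toLp 2 fun j => pairing u.1 (g j) : EuclideanSpace ℝ (Fin m))‖ ^ 2 +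
        truncNormSq K u ≤ R ^ 2 * (Sg + 1) + 1 := by
      have h1 := norm_cylXi_sq_le hg hu
      have h2 := truncNormSq_le K u
      have h3 : ‖u‖ ^ 2 ≤ R ^ 2 := pow_le_pow_left₀ (norm_nonneg _) hu 2
      rw [← hSg] at h1
      nlinarith
    rw [hΨ u hball,
      cylGI_nsGeneratorPairing_add_smul ν hf u
        (isSmooth_sum_smul Finset.univ _ fun j _ => hg j) _ K]
    simp only [hA, hB]
    ring
  -- `B` is integrable: a bounded continuous weight times the integrable balance
  obtain ⟨M, -, hM⟩ := exists_bound_fderiv_cylXi hg hψ R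
  have hBint : Integrable B μ := by
    refine (cylGI_integrable_galerkinBalance hμ hR K).bdd_mul
      (continuous_fderiv_cylXi hg hψ (cylGI_continuous_truncNormSq K) _).aestronglyMeasurable
      (c := M * ‖((0 : EuclideanSpace ℝ (Fin m)), (1 : ℝ))‖) ?_
    filter_upwards [hR] with u hu
    rw [Real.norm_eq_abs]
    exact hM u hu _ (cylGI_abs_truncNormSq_le hu K) _
  -- `A` is integrable: `A = ⟨F, Ψ'⟩ - 2 B` a.e.
  have hAint : Integrable A μ := by
    refine (hLint.sub (hBint.const_mul 2)).congr ?_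
    filter_upwards [hae] with u hu
    rw [Pi.sub_apply, hu]
    ring
  refine ⟨hAint, hBint, ?_⟩
  have h1 : ∫ u, nsGeneratorPairing ν f u (Ψ.grad u) ∂μ = ∫ u, (A u + 2 * B u) ∂μ :=
    integral_congr_ae hae
  rw [integral_add hAint (hBint.const_mul 2), integral_const_mul] at h1
  linarith

end Summit.AnomalousDissipation.AnomalousDissipation.Theorems.EnsembleRealization
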